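import Mathlib
import Summits.Ventures.PercRepro2.HCovCubic

/-!
# `K₃` with ONE typed edge: the three-placement expansion of the type-`2` sum
(blind cell PercRepro2, night-3 g20, 2026-08-28; `proofs/NIGHT3-CERT.md` §29)

With one typed edge `e` of type `2` and every other edge weighted, the typed three-copy sum of a
separable kernel splits into the three placements of the copy in which `e` is closed
(`weight3_two`, `triSum_singleton_two_sep`):

  `T₂ = (1 − p_e) p_e² · [E⁰f E¹g E¹h + E¹f E⁰g E¹h + E¹f E¹g E⁰h]`,   `E^s = E_{p[e := s]}`,

so the one-edge Bernstein coefficient `N₂` of `Gc` mixes the deletion `p[e := 0]` and the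
contraction `p[e := 1]` in every term. `triSum_singleton_two_K3` is the explicit form for p1's
kernel `K₃` (`K3_explicit`: the eight terms; `mix3`: the three placements), in the pattern masses
of `HCov.lean` under the two pinned laws — the vocabulary for the weighted row (W-ROW-23) of
`WeightedRows.lean` (used by `WeightedRowInactive.lean`). Also the linearity of `triSum` in the
kernel (`triSum_add`, `triSum_sub`). Own work; standard axioms.
-/

namespace Summit.Ventures.PercRepro2

open UnionCluster

namespace CovForm

/-! ## The one-typed-edge expansion of a separable kernel -/

section OneTypedSep

variable {E : Type*} [Fintype E] [DecidableEq E] {R : Type*} [Field R]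

/-- The three-copy weight with `e` open in exactly two copies is the sum of the three placements of
the closed copy, each copy pinned at `e`. -/
lemma weight3_two (p : E → R) (e : E) (x y z : Config E) :
    (if openCount x y z e = 2 then weight p x * weight p y * weight p z else 0) =
      (1 - p e) * p e * p e * (weight (Function.update p e 0) x *
          (weight (Function.update p e 1) y * weight (Function.update p e 1) z)) +
        p e * (1 - p e) * p e * (weight (Function.update p e 1) x *
          (weight (Function.update p e 0) y * weight (Function.update p e 1) z)) +
        p e * p e * (1 - p e) * (weight (Function.update p e 1) x *
          (weight (Function.update p e 1) y * weight (Function.update p e 0) z)) := by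
  rw [weight_eq_pin p x e, weight_eq_pin p y e, weight_eq_pin p z e]
  cases hxe : x e <;> cases hye : y e <;> cases hze : z e <;>
    simp only [openCount, hxe, hye, hze, Bool.toNat_true, Bool.toNat_false,
      weight_update_one_of_eq_false, weight_update_zero_of_eq_true,
      mul_zero, zero_mul, add_zero, zero_add] <;> norm_num <;> ring

/-- A triple sum of a product of one-copy functions factorises. -/
lemma sum3_sep (u v t f g h : Config E → R) :
    (∑ x : Config E, ∑ y : Config E, ∑ z : Config E,
        u x * (v y * t z) * (f x * (g y * h z))) =
      (∑ x, u x * f x) * ((∑ y, v y * g y) * (∑ z, t z * h z)) := by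
  have h1 : (∑ y, v y * g y) * (∑ z, t z * h z) = ∑ y, ∑ z, (v y * g y) * (t z * h z) :=
    Finset.sum_mul_sum Finset.univ Finset.univ (fun y => v y * g y) (fun z => t z * h z)
  have h2 : (∑ x, u x * f x) * (∑ y, ∑ z, (v y * g y) * (t z * h z)) =
      ∑ x, ∑ y, (u x * f x) * ∑ z, (v y * g y) * (t z * h z) :=
    Finset.sum_mul_sum Finset.univ Finset.univ (fun x => u x * f x)
      (fun y => ∑ z, (v y * g y) * (t z * h z))
  rw [h1, h2]
  refine Finset.sum_congr rfl fun x _ => ?_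
  refine Finset.sum_congr rfl fun y _ => ?_
  rw [Finset.mul_sum]
  refine Finset.sum_congr rfl fun z _ => ?_
  ring

/-- **The one-typed-edge (type `2`) sum of a separable term**: the three placements of the closed
copy, each an expectation under `p[e := 0]` or `p[e := 1]`. -/
theorem triSum_singleton_two_sep (p : E → R) (e : E) (τ : E → ℕ) (hτ : τ e = 2)
    (f g h : Config E → R) :
    triSum p {e} τ (fun x y z => f x * (g y * h z)) =
      (1 - p e) * p e * p e * (expect (Function.update p e 0) f *
          (expect (Function.update p e 1) g * expect (Function.update p e 1) h)) +
        p e * (1 - p e) * p e * (expect (Function.update p e 1) f *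
          (expect (Function.update p e 0) g * expect (Function.update p e 1) h)) +
        p e * p e * (1 - p e) * (expect (Function.update p e 1) f *
          (expect (Function.update p e 1) g * expect (Function.update p e 0) h)) := by
  unfold triSum
  simp only [Finset.mem_singleton, forall_eq, hτ]
  have hsplit : ∀ x y z : Config E,
      (if openCount x y z e = 2 then weight p x * weight p y * weight p z * (f x * (g y * h z))
        else 0) =
      (1 - p e) * p e * p e * (weight (Function.update p e 0) x *
          (weight (Function.update p e 1) y * weight (Function.update p e 1) z) *
          (f x * (g y * h z))) +
        p e * (1 - p e) * p e * (weight (Function.update p e 1) x *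
          (weight (Function.update p e 0) y * weight (Function.update p e 1) z) *
          (f x * (g y * h z))) +
        p e * p e * (1 - p e) * (weight (Function.update p e 1) x *
          (weight (Function.update p e 1) y * weight (Function.update p e 0) z) *
          (f x * (g y * h z))) := by
    intro x y z
    have hw := weight3_two p e x y z
    have hite : (if openCount x y z e = 2 then
        weight p x * weight p y * weight p z * (f x * (g y * h z)) else 0) =
        (if openCount x y z e = 2 then weight p x * weight p y * weight p z else 0) *
          (f x * (g y * h z)) := by
      split_ifs <;> simp
    rw [hite, hw]
    ring
  simp only [hsplit, Finset.sum_add_distrib, ← Finset.mul_sum]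
  simp only [expect]
  rw [sum3_sep, sum3_sep, sum3_sep]

/-- The one-typed-edge (type `2`) sum of a finite sum of separable kernels. -/
theorem triSum_singleton_two_sepKernel (p : E → R) (e : E) (τ : E → ℕ) (hτ : τ e = 2) {n : ℕ}
    (c : Fin n → R) (f g h : Fin n → Config E → R) :
    triSum p {e} τ (sepKernel c f g h) =
      ∑ i, c i * ((1 - p e) * p e * p e * (expect (Function.update p e 0) (f i) *
          (expect (Function.update p e 1) (g i) * expect (Function.update p e 1) (h i))) +
        p e * (1 - p e) * p e * (expect (Function.update p e 1) (f i) *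
          (expect (Function.update p e 0) (g i) * expect (Function.update p e 1) (h i))) +
        p e * p e * (1 - p e) * (expect (Function.update p e 1) (f i) *
          (expect (Function.update p e 1) (g i) * expect (Function.update p e 0) (h i)))) := by
  have hlin : triSum p {e} τ (sepKernel c f g h) =
      ∑ i, c i * triSum p {e} τ (fun x y z => f i x * (g i y * h i z)) := by
    unfold triSum sepKernel
    have hc : ∀ x y z : Config E, (if ∀ e' ∈ ({e} : Finset E), openCount x y z e' = τ e' then
        weight p x * weight p y * weight p z * ∑ i, c i * (f i x * (g i y * h i z)) else 0) =
        ∑ i, c i * (if ∀ e' ∈ ({e} : Finset E), openCount x y z e' = τ e' then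
          weight p x * weight p y * weight p z * (f i x * (g i y * h i z)) else 0) := by
      intro x y z
      split_ifs with hcond
      · rw [Finset.mul_sum]
        refine Finset.sum_congr rfl fun i _ => ?_
        ring
      · simp
    simp only [hc]
    rw [sum_comm4]
    refine Finset.sum_congr rfl fun i _ => ?_
    simp only [← Finset.mul_sum]
  rw [hlin]
  refine Finset.sum_congr rfl fun i _ => ?_
  rw [triSum_singleton_two_sep p e τ hτ]

/-- Linearity of the typed sum in the kernel: sums. -/
lemma triSum_add (p : E → R) (F : Finset E) (τ : E → ℕ)
    (K₁ K₂ : Config E → Config E → Config E → R) :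
    triSum p F τ (fun x y z => K₁ x y z + K₂ x y z) = triSum p F τ K₁ + triSum p F τ K₂ := by
  unfold triSum
  simp only [← Finset.sum_add_distrib]
  refine Finset.sum_congr rfl fun x _ => ?_
  refine Finset.sum_congr rfl fun y _ => ?_
  refine Finset.sum_congr rfl fun z _ => ?_
  split_ifs <;> ring

/-- Linearity of the typed sum in the kernel: differences. -/
lemma triSum_sub (p : E → R) (F : Finset E) (τ : E → ℕ)
    (K₁ K₂ : Config E → Config E → Config E → R) :
    triSum p F τ (fun x y z => K₁ x y z - K₂ x y z) = triSum p F τ K₁ - triSum p F τ K₂ := by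
  unfold triSum
  simp only [← Finset.sum_sub_distrib]
  refine Finset.sum_congr rfl fun x _ => ?_
  refine Finset.sum_congr rfl fun y _ => ?_
  refine Finset.sum_congr rfl fun z _ => ?_
  split_ifs <;> ring

end OneTypedSep

/-! ## `K₃` with one typed edge, and the `a₃`-inactive row identity -/

section K3Row

variable {V : Type*} {E : Type*} [Fintype E] [DecidableEq E] {R : Type*}
  [Field R] [LinearOrder R] [IsStrictOrderedRing R]

omit [Fintype E] [DecidableEq E] [LinearOrder R] [IsStrictOrderedRing R] in
/-- The explicit eight-term form of `K₃` (`P1-TWOCOPY.md` §8), as a function of the three copies. -/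
theorem K3_explicit (ends : E → Sym2 V) (o a₁ a₂ a₃ b : V) (x y z : Config E) :
    K3 ends o a₁ a₂ a₃ b x y z =
      (iPD ends a₁ a₂ a₃ x : R) * (iQ ends a₁ a₂ y * f4 ends o a₁ a₂ b z) +
        iQ ends a₁ a₂ x * (f3 ends o a₁ a₂ a₃ y * f5 ends a₁ a₂ a₃ b z) -
        iPD ends a₁ a₂ a₃ x * (iQ ends a₁ a₂ y * f6 ends o a₁ a₂ a₃ b z) -
        iPD ends a₁ a₂ a₃ x * (f7 ends a₁ a₂ b y * f7 ends a₁ a₂ o z) -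
        f3 ends o a₁ a₂ a₃ x * (f7 ends a₁ a₂ b y * f7 ends a₁ a₂ a₃ z) +
        iPD ends a₁ a₂ a₃ x * (f7 ends a₁ a₂ b y * f10 ends o a₁ a₂ a₃ z) -
        iPD ends a₁ a₂ a₃ x * (iQ ends a₁ a₂ y * f11 ends o a₁ a₂ a₃ b z) +
        iQ ends a₁ a₂ x * (f12 ends a₁ a₂ a₃ b y * f3 ends o a₁ a₂ a₃ z) := by
  unfold K3 sepKernel
  rw [Fin.sum_univ_eight]
  simp only [Matrix.cons_val]
  ring

/-- The three placements of the closed copy: `(1 − t) t t · A₀ B₁ C₁ + t (1 − t) t · A₁ B₀ C₁ +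
t t (1 − t) · A₁ B₁ C₀`. -/
def mix3 (t A₀ A₁ B₀ B₁ C₀ C₁ : R) : R :=
  (1 - t) * t * t * (A₀ * (B₁ * C₁)) + t * (1 - t) * t * (A₁ * (B₀ * C₁)) +
    t * t * (1 - t) * (A₁ * (B₁ * C₀))

/-- **`K₃` with one typed edge of type `2`**: the eight terms, each the three mixed products of
the pattern masses under the deletion `q₀ = p[e := 0]` and the contraction `q₁ = p[e := 1]`. -/
theorem triSum_singleton_two_K3 (p : E → R) (e : E) (τ : E → ℕ) (hτ : τ e = 2)
    (ends : E → Sym2 V) (o a₁ a₂ a₃ b : V) :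
    triSum p {e} τ (K3 ends o a₁ a₂ a₃ b) =
      mix3 (p e) (prob (Function.update p e 0) (PDEvent ends a₁ a₂ a₃))
          (prob (Function.update p e 1) (PDEvent ends a₁ a₂ a₃))
          (prob (Function.update p e 0) (avoidAll ends a₂ {a₁}))
          (prob (Function.update p e 1) (avoidAll ends a₂ {a₁}))
          (EQbo (Function.update p e 0) ends o a₁ a₂ b) (EQbo (Function.update p e 1) ends o a₁ a₂ b) +
        mix3 (p e) (prob (Function.update p e 0) (avoidAll ends a₂ {a₁}))
          (prob (Function.update p e 1) (avoidAll ends a₂ {a₁}))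
          (Do (Function.update p e 0) ends o a₁ a₂ a₃) (Do (Function.update p e 1) ends o a₁ a₂ a₃)
          (EQb3 (Function.update p e 0) ends a₁ a₂ a₃ b) (EQb3 (Function.update p e 1) ends a₁ a₂ a₃ b) -
        mix3 (p e) (prob (Function.update p e 0) (PDEvent ends a₁ a₂ a₃))
          (prob (Function.update p e 1) (PDEvent ends a₁ a₂ a₃))
          (prob (Function.update p e 0) (avoidAll ends a₂ {a₁}))
          (prob (Function.update p e 1) (avoidAll ends a₂ {a₁}))
          (EQb3o (Function.update p e 0) ends o a₁ a₂ a₃ b)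
          (EQb3o (Function.update p e 1) ends o a₁ a₂ a₃ b) -
        mix3 (p e) (prob (Function.update p e 0) (PDEvent ends a₁ a₂ a₃))
          (prob (Function.update p e 1) (PDEvent ends a₁ a₂ a₃))
          (-gap (Function.update p e 0) ends a₁ a₂ b) (-gap (Function.update p e 1) ends a₁ a₂ b)
          (EQo (Function.update p e 0) ends o a₁ a₂) (EQo (Function.update p e 1) ends o a₁ a₂) -
        mix3 (p e) (Do (Function.update p e 0) ends o a₁ a₂ a₃) (Do (Function.update p e 1) ends o a₁ a₂ a₃)
          (-gap (Function.update p e 0) ends a₁ a₂ b) (-gap (Function.update p e 1) ends a₁ a₂ b)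
          (EQ3 (Function.update p e 0) ends a₁ a₂ a₃) (EQ3 (Function.update p e 1) ends a₁ a₂ a₃) +
        mix3 (p e) (prob (Function.update p e 0) (PDEvent ends a₁ a₂ a₃))
          (prob (Function.update p e 1) (PDEvent ends a₁ a₂ a₃))
          (-gap (Function.update p e 0) ends a₁ a₂ b) (-gap (Function.update p e 1) ends a₁ a₂ b)
          (EQ3o (Function.update p e 0) ends o a₁ a₂ a₃) (EQ3o (Function.update p e 1) ends o a₁ a₂ a₃) -
        mix3 (p e) (prob (Function.update p e 0) (PDEvent ends a₁ a₂ a₃))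
          (prob (Function.update p e 1) (PDEvent ends a₁ a₂ a₃))
          (prob (Function.update p e 0) (avoidAll ends a₂ {a₁}))
          (prob (Function.update p e 1) (avoidAll ends a₂ {a₁}))
          (PDbo (Function.update p e 0) ends o a₁ a₂ a₃ b) (PDbo (Function.update p e 1) ends o a₁ a₂ a₃ b) +
        mix3 (p e) (prob (Function.update p e 0) (avoidAll ends a₂ {a₁}))
          (prob (Function.update p e 1) (avoidAll ends a₂ {a₁}))
          (PDb (Function.update p e 0) ends a₁ a₂ a₃ b) (PDb (Function.update p e 1) ends a₁ a₂ a₃ b)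
          (Do (Function.update p e 0) ends o a₁ a₂ a₃) (Do (Function.update p e 1) ends o a₁ a₂ a₃) := by
  have hK : K3 (R := R) ends o a₁ a₂ a₃ b = fun x y z =>
      (iPD ends a₁ a₂ a₃ x : R) * (iQ ends a₁ a₂ y * f4 ends o a₁ a₂ b z) +
        iQ ends a₁ a₂ x * (f3 ends o a₁ a₂ a₃ y * f5 ends a₁ a₂ a₃ b z) -
        iPD ends a₁ a₂ a₃ x * (iQ ends a₁ a₂ y * f6 ends o a₁ a₂ a₃ b z) -
        iPD ends a₁ a₂ a₃ x * (f7 ends a₁ a₂ b y * f7 ends a₁ a₂ o z) -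
        f3 ends o a₁ a₂ a₃ x * (f7 ends a₁ a₂ b y * f7 ends a₁ a₂ a₃ z) +
        iPD ends a₁ a₂ a₃ x * (f7 ends a₁ a₂ b y * f10 ends o a₁ a₂ a₃ z) -
        iPD ends a₁ a₂ a₃ x * (iQ ends a₁ a₂ y * f11 ends o a₁ a₂ a₃ b z) +
        iQ ends a₁ a₂ x * (f12 ends a₁ a₂ a₃ b y * f3 ends o a₁ a₂ a₃ z) := by
    funext x y z
    exact K3_explicit ends o a₁ a₂ a₃ b x y z
  rw [hK, triSum_add, triSum_sub, triSum_add, triSum_sub, triSum_sub, triSum_sub, triSum_add,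
    triSum_singleton_two_sep p e τ hτ, triSum_singleton_two_sep p e τ hτ,
    triSum_singleton_two_sep p e τ hτ, triSum_singleton_two_sep p e τ hτ,
    triSum_singleton_two_sep p e τ hτ, triSum_singleton_two_sep p e τ hτ,
    triSum_singleton_two_sep p e τ hτ, triSum_singleton_two_sep p e τ hτ]
  rw [expect_f1 (Function.update p e 0) ends a₁ a₂,
    expect_f2 (Function.update p e 0) ends a₁ a₂ a₃,
    expect_f3 (Function.update p e 0) ends o a₁ a₂ a₃,
    expect_f4 (Function.update p e 0) ends o a₁ a₂ b,
    expect_f5 (Function.update p e 0) ends a₁ a₂ a₃ b,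
    expect_f6 (Function.update p e 0) ends o a₁ a₂ a₃ b,
    expect_f7 (Function.update p e 0) ends a₁ a₂ b,
    expect_f8 (Function.update p e 0) ends o a₁ a₂,
    expect_f9 (Function.update p e 0) ends a₁ a₂ a₃,
    expect_f10 (Function.update p e 0) ends o a₁ a₂ a₃,
    expect_f11 (Function.update p e 0) ends o a₁ a₂ a₃ b,
    expect_f12 (Function.update p e 0) ends a₁ a₂ a₃ b,
    expect_f1 (Function.update p e 1) ends a₁ a₂,
    expect_f2 (Function.update p e 1) ends a₁ a₂ a₃,
    expect_f3 (Function.update p e 1) ends o a₁ a₂ a₃,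
    expect_f4 (Function.update p e 1) ends o a₁ a₂ b,
    expect_f5 (Function.update p e 1) ends a₁ a₂ a₃ b,
    expect_f6 (Function.update p e 1) ends o a₁ a₂ a₃ b,
    expect_f7 (Function.update p e 1) ends a₁ a₂ b,
    expect_f8 (Function.update p e 1) ends o a₁ a₂,
    expect_f9 (Function.update p e 1) ends a₁ a₂ a₃,
    expect_f10 (Function.update p e 1) ends o a₁ a₂ a₃,
    expect_f11 (Function.update p e 1) ends o a₁ a₂ a₃ b,
    expect_f12 (Function.update p e 1) ends a₁ a₂ a₃ b]
  unfold mix3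
  ring

end K3Row

end CovForm

end Summit.Ventures.PercRepro2
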